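/-
Copyright: the b2b-balaban T⁴-continuum CRUX team, row NE7b OWNER lineage `t4-ne7b-p1` (gen 140). Project licence.
-/
import Summits.QuantumFields.BalabanUV.T4Continuum.Spine.NE7b.SupWhitenedMomentLetters
import Summits.QuantumFields.BalabanUV.T4Continuum.Spine.NE7b.SupKernelTaylorExtraction

/-!
# THE TWO-POINT PIECE OF `∂³W`'S KERNEL LETTER: `Σ_{y,z}|Cov_ν(U″[e_x,e_y], U′[e_z])|` FOR A GENERAL `Γ = AAᵀ` (SCOPING (d12)(1)(ii)).  In the
# cumulant form `∂³W = ⟨U‴⟩ − Σ_{3 perms}Cov(U″, U′) + κ₃` the middle terms pair a HESSIAN ENTRY of the input with a gradient component under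
# the tilted law.  In whitened coordinates the Hessian-entry observable `G_{xy}(ξ) = U″(Aξ+ψ)(e_x)(e_y)` is in the coordinate-Lipschitz class
# with vector `g^{xy}_w = Σ_u|A_{uw}|·K3_{xyu}` for any entrywise THIRD-derivative majorant `|U‴(φ)[e_u][e_x][e_y]| ≤ K3_{xyu}` (mean value
# along `s ↦ U″(φ + sAe_w)e_xe_y`, (438)'s first-slot expansion), so (447) gives, with the third row letter `Σ_yΣ_uK3_{xyu} ≤ k3r`,
#   `Σ_y Σ_z |Cov_ν(G_{xy}, F_z)| ≤ (αr·k3r)·(αc·hc)·(1−γ)⁻¹(1−γ′)⁻¹∕(1−lamA)`   — uniformly in `ψ` and the volume, under `N(0,AAᵀ)`, SMALLNESS only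
# (row NE7b, node U5c; (432) `hasDerivAt_line2`, (438) `expand_first_slot`, (447), (448), (456)–(458) BY NAME; [folklore])

Cell `pub-balaban`, sub-cell `t4`, spine estimate NE7b (`T4WeightBudget.RelWeightBound`; the cell's OWN estimate — NOT PRINTED in
[Bałaban 1983–89], NOT PROVED).  Crux-route work under `Spine/NE7b/` by the row OWNER (`t4-ne7b-p1` gen 140, file (469)) under FREEZE
(0)'s crux-prover clause; NOTHING of Bałaban's is named as a Lean object, valued or asserted; no `T4Continuum/Support` leaf typed; no
`def`, no notation; zero `sorry`.  Imports (BY NAME): the OWNER's (458) `…SupWhitenedMomentLetters` (moment letters; through it (457)'s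
structural letters and bridges, (456)'s letters, (447) `cov_rowsum_le_gibbs`, (448) `neumann_*`), (438) `…SupKernelTaylorExtraction`
(`expand_first_slot`; through it (432) `hasDerivAt_line2`).

WHAT IS PROVED ([folklore]; `U ∈ C³` with `U‴ = U₃`, majorants `Hk` (Hessian) and `K3` (third), factor `A`):
* §1 `third_first_slot_majorant` (`|U₃φ(Te_w)e_xe_y| ≤ Σ_u|A_{uw}|K3_{xyu}`), **`hessian_obs_lipschitz`**, **`hessian_obs_lipVec`** (the Hessian-entry
  observable is in the class), `hessian_obs_mass_le` (`Σ_yΣ_w g^{xy}_w ≤ αr·k3r`).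
* §2 **`whitened_hessgrad_cov_raw`** (the double sum in the whitened Gibbs format, Neumann `D`).
* §3 THE END **`whitened_hessgrad_cov_kernel_letter`** (the double sum under `N(0,AAᵀ)`, moment letters discharged).

HONEST (what this is NOT).  The two-point piece only; the average piece `⟨U‴⟩` and the cumulant form of `∂³W` for general `Γ` are the
successor's ((d12)(1)(i),(iii)); the third cumulant piece is (468).  Scalar skeleton ((A3), NC-NE7b-α UNRULED); nothing of Bałaban's asserted.
BY-NAME EFFECT ON THE WALL: NONE.  NE7b NOT PRINTED ∕ NOT PROVED; spine PROVED 0∕9; rung (B)+1 — the programme's measures remain FINITE-torus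
statements; NOT the mass gap, NOT Clay.  HONEST DEPENDENCY: continuum YM on T⁴ ⇐ BetaPertH ∧ nine spine estimates (0∕9 proved); BetaPertH ⇐
(D1) ∧ (D4) ∧ CAP+tail; G-an2-4 gates asym, D1 and NE2∕3∕4.
-/

set_option autoImplicit false
set_option maxSynthPendingDepth 3

noncomputable section

namespace Summit.QuantumFields.BalabanUV.T4Continuum.NE7b.SupWhitenedHessianGradientCovariance

open MeasureTheory ProbabilityTheory Real Set Function Finset Matrix
open scoped BigOperators
open Literature.Probability.Distributions (matrixCLM)
open SupWhitenedMomentLetters (whitened_exp_integrable whitened_second_moment_integrable)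
open SupWhitenedCovarianceKernelLetter (whitenedV_hasDerivAt whitenedV_floor whitenedV_ceiling whitenedV_cross whitenedV_continuous
  whitened_integrable_lebesgue whitened_tilted_eq_gauss whitened_integral_eq)
open SupWhitenedFirstOrderLetters (matrixCLM_single_apply whitened_line toLp_update_zero whitened_obs_lipVec whitened_cross_nonneg
  whitened_J_rowsum_le whitened_J_colsum_le whitened_obs_nonneg whitened_obs_colsum_le)
open SupDobrushinCovarianceGibbs (cov_rowsum_le_gibbs)
open SupDobrushinNeumannMatrix (neumann_nonneg neumann_dominates neumann_rowsum_le neumann_colsum_le)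
open SupKernelTaylorExtraction (expand_first_slot)
open SupTaylorExtractionLetters (hasDerivAt_line2)

variable {ι κ : Type} [Fintype ι] [DecidableEq ι] [Fintype κ] [DecidableEq κ]

variable {U : EuclideanSpace ℝ ι → ℝ} {U' : EuclideanSpace ℝ ι → EuclideanSpace ℝ ι →L[ℝ] ℝ}
  {U'' : EuclideanSpace ℝ ι → EuclideanSpace ℝ ι →L[ℝ] EuclideanSpace ℝ ι →L[ℝ] ℝ}
  {U₃ : EuclideanSpace ℝ ι → EuclideanSpace ℝ ι →L[ℝ] EuclideanSpace ℝ ι →L[ℝ] EuclideanSpace ℝ ι →L[ℝ] ℝ} {Hk : ι → ι → ℝ} {K3 : ι → ι → ι → ℝ}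
  {A : Matrix ι κ ℝ} {ψ : EuclideanSpace ℝ ι} {γop κ₀ κ₁ κ₂ a τ δ θ αr αc hr hc k3r lamA γ γ' : ℝ}

/-! ## §1. The Hessian-entry observable `G_{xy}(ξ) = U″(Tξ+ψ)(e_x)(e_y)` -/

/-- **First-slot majorant of the third derivative**: `|U₃φ(Te_w)e_xe_y| ≤ Σ_u|A_{uw}|K3_{xyu}`. [folklore] -/
theorem third_first_slot_majorant (hK3 : ∀ (φ : EuclideanSpace ℝ ι) (u x y : ι),
      |U₃ φ (EuclideanSpace.single u (1 : ℝ)) (EuclideanSpace.single x (1 : ℝ)) (EuclideanSpace.single y (1 : ℝ))| ≤ K3 x y u)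
    (A : Matrix ι κ ℝ) (φ : EuclideanSpace ℝ ι) (w : κ) (x y : ι) :
    |U₃ φ (matrixCLM A (EuclideanSpace.single w (1 : ℝ))) (EuclideanSpace.single x (1 : ℝ)) (EuclideanSpace.single y (1 : ℝ))| ≤ ∑ u, |A u w| * K3 x y u := by
  rw [expand_first_slot (U₃ φ)]
  refine (Finset.abs_sum_le_sum_abs _ _).trans (Finset.sum_le_sum fun u _ => ?_)
  rw [abs_mul, matrixCLM_single_apply]
  exact mul_le_mul_of_nonneg_left (hK3 φ u x y) (abs_nonneg _)

/-- **The Hessian-entry observable is `ξ`-Lipschitz** (shift format):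
`|U″(T(ξ + r•e_w)+ψ)e_xe_y − U″(Tξ+ψ)e_xe_y| ≤ (Σ_u|A_{uw}|K3_{xyu})·|r|`. [folklore] -/
theorem hessian_obs_lipschitz (hU''d : ∀ φ : EuclideanSpace ℝ ι, HasFDerivAt U'' (U₃ φ) φ)
    (hK3 : ∀ (φ : EuclideanSpace ℝ ι) (u x y : ι),
      |U₃ φ (EuclideanSpace.single u (1 : ℝ)) (EuclideanSpace.single x (1 : ℝ)) (EuclideanSpace.single y (1 : ℝ))| ≤ K3 x y u)
    (A : Matrix ι κ ℝ) (ψ : EuclideanSpace ℝ ι) (x y : ι) (w : κ) (ξ : EuclideanSpace ℝ κ) (r : ℝ) :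
    |U'' (matrixCLM A (ξ + r • EuclideanSpace.single w (1 : ℝ)) + ψ) (EuclideanSpace.single x (1 : ℝ)) (EuclideanSpace.single y (1 : ℝ)) -
        U'' (matrixCLM A ξ + ψ) (EuclideanSpace.single x (1 : ℝ)) (EuclideanSpace.single y (1 : ℝ))| ≤ (∑ u, |A u w| * K3 x y u) * |r| := by
  rw [whitened_line]
  set φ : EuclideanSpace ℝ ι := matrixCLM A ξ + ψ with hφ
  have hd : ∀ s ∈ (univ : Set ℝ), HasDerivWithinAt (fun s : ℝ => U'' (φ + s • matrixCLM A (EuclideanSpace.single w (1 : ℝ)))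
      (EuclideanSpace.single x (1 : ℝ)) (EuclideanSpace.single y (1 : ℝ)))
      (U₃ (φ + s • matrixCLM A (EuclideanSpace.single w (1 : ℝ))) (matrixCLM A (EuclideanSpace.single w (1 : ℝ))) (EuclideanSpace.single x (1 : ℝ))
        (EuclideanSpace.single y (1 : ℝ))) univ s :=
    fun s _ => (hasDerivAt_line2 hU''d φ _ _ _ s).hasDerivWithinAt
  have hb : ∀ s ∈ (univ : Set ℝ), ‖U₃ (φ + s • matrixCLM A (EuclideanSpace.single w (1 : ℝ))) (matrixCLM A (EuclideanSpace.single w (1 : ℝ)))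
      (EuclideanSpace.single x (1 : ℝ)) (EuclideanSpace.single y (1 : ℝ))‖ ≤ ∑ u, |A u w| * K3 x y u := fun s _ => by
    rw [Real.norm_eq_abs]
    exact third_first_slot_majorant hK3 A _ w x y
  have h := convex_univ.norm_image_sub_le_of_norm_hasDerivWithin_le hd hb (mem_univ 0) (mem_univ r)
  simp only [zero_smul, add_zero, sub_zero, Real.norm_eq_abs] at h
  exact h

/-- **The Hessian-entry observable in (447)'s `update` format**. [folklore] -/
theorem hessian_obs_lipVec (hU''d : ∀ φ : EuclideanSpace ℝ ι, HasFDerivAt U'' (U₃ φ) φ)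
    (hK3 : ∀ (φ : EuclideanSpace ℝ ι) (u x y : ι),
      |U₃ φ (EuclideanSpace.single u (1 : ℝ)) (EuclideanSpace.single x (1 : ℝ)) (EuclideanSpace.single y (1 : ℝ))| ≤ K3 x y u)
    (A : Matrix ι κ ℝ) (ψ : EuclideanSpace ℝ ι) (x y : ι) (w : κ) (z : κ → ℝ) (s t : ℝ) :
    |U'' (matrixCLM A (WithLp.toLp 2 (update z w s)) + ψ) (EuclideanSpace.single x (1 : ℝ)) (EuclideanSpace.single y (1 : ℝ)) -
        U'' (matrixCLM A (WithLp.toLp 2 (update z w t)) + ψ) (EuclideanSpace.single x (1 : ℝ)) (EuclideanSpace.single y (1 : ℝ))| ≤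
      (∑ u, |A u w| * K3 x y u) * |s - t| := by
  rw [toLp_update_zero z w s t]
  exact hessian_obs_lipschitz hU''d hK3 A ψ x y w _ (s - t)

omit [DecidableEq ι] [DecidableEq κ] in
/-- **The mass of the Hessian-entry observables' vectors over `y`**: `Σ_yΣ_w Σ_u|A_{uw}|K3_{xyu} ≤ αr·k3r` for the third row letter
`Σ_yΣ_uK3_{xyu} ≤ k3r` and `K3 ≥ 0`. [folklore] -/
theorem hessian_obs_mass_le (hK30 : ∀ x y u, 0 ≤ K3 x y u) (hαr : ∀ u, ∑ w, |A u w| ≤ αr) (hk3r : ∀ x, ∑ y, ∑ u, K3 x y u ≤ k3r) (x : ι) :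
    ∑ y, ∑ w, ∑ u, |A u w| * K3 x y u ≤ αr * k3r := by
  rcases isEmpty_or_nonempty ι with hι | ⟨⟨u₀⟩⟩
  · exact (hι.false x).elim
  have hαr0 : 0 ≤ αr := (Finset.sum_nonneg fun w _ => abs_nonneg (A u₀ w)).trans (hαr u₀)
  calc ∑ y, ∑ w, ∑ u, |A u w| * K3 x y u = ∑ y, ∑ u, K3 x y u * ∑ w, |A u w| := by
        refine Finset.sum_congr rfl fun y _ => ?_
        rw [Finset.sum_comm]
        exact Finset.sum_congr rfl fun u _ => by rw [Finset.mul_sum]; exact Finset.sum_congr rfl fun w _ => by ring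
    _ ≤ ∑ y, ∑ u, K3 x y u * αr := Finset.sum_le_sum fun y _ => Finset.sum_le_sum fun u _ => mul_le_mul_of_nonneg_left (hαr u) (hK30 x y u)
    _ = αr * ∑ y, ∑ u, K3 x y u := by rw [Finset.mul_sum]; exact Finset.sum_congr rfl fun y _ => by rw [Finset.mul_sum]; exact Finset.sum_congr rfl fun u _ => by ring
    _ ≤ αr * k3r := mul_le_mul_of_nonneg_left (hk3r x) hαr0

/-! ## §2. The double sum in the whitened Gibbs format -/

/-- **THE TWO-POINT PIECE IN WHITENED COORDINATES**: `Σ_y Σ_z |Cov_ν(G_{xy}, F_z)| ≤ (αr·k3r)·(αc·hc)·(1−γ)⁻¹(1−γ′)⁻¹∕(1−lamA)`. [folklore] -/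
theorem whitened_hessgrad_cov_raw [Nonempty κ] (hUd : ∀ φ : EuclideanSpace ℝ ι, HasFDerivAt U (U' φ) φ)
    (hU'd : ∀ φ : EuclideanSpace ℝ ι, HasFDerivAt U' (U'' φ) φ) (hU''d : ∀ φ : EuclideanSpace ℝ ι, HasFDerivAt U'' (U₃ φ) φ)
    (hHk : ∀ (φ : EuclideanSpace ℝ ι) (x z : ι), |U'' φ (EuclideanSpace.single z (1 : ℝ)) (EuclideanSpace.single x (1 : ℝ))| ≤ Hk x z)
    (hHk0 : ∀ v u, 0 ≤ Hk v u)
    (hK3 : ∀ (φ : EuclideanSpace ℝ ι) (u x y : ι),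
      |U₃ φ (EuclideanSpace.single u (1 : ℝ)) (EuclideanSpace.single x (1 : ℝ)) (EuclideanSpace.single y (1 : ℝ))| ≤ K3 x y u)
    (hK30 : ∀ x y u, 0 ≤ K3 x y u) (A : Matrix ι κ ℝ) (ψ : EuclideanSpace ℝ ι)
    (hαr : ∀ u, ∑ w, |A u w| ≤ αr) (hαc : ∀ w, ∑ u, |A u w| ≤ αc) (hhr : ∀ v, ∑ u, Hk v u ≤ hr) (hhc : ∀ u, ∑ v, Hk v u ≤ hc)
    (hk3r : ∀ x, ∑ y, ∑ u, K3 x y u ≤ k3r)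
    (hlam : ∀ x : κ, ∑ u, ∑ v, |A u x| * |A v x| * Hk v u ≤ lamA) (hlam1 : lamA < 1)
    (hγ : αc * hr * αr / (1 - lamA) ≤ γ) (hγ1 : γ < 1) (hγ' : αc * hc * αr / (1 - lamA) ≤ γ') (hγ'1 : γ' < 1)
    (hI0 : Integrable (fun ξ : EuclideanSpace ℝ κ => exp (-U (matrixCLM A ξ + ψ))) (multivariateGaussian 0 (1 : Matrix κ κ ℝ)))
    (hI2 : ∀ w, Integrable (fun ξ : EuclideanSpace ℝ κ => exp (-U (matrixCLM A ξ + ψ)) * ξ w ^ 2) (multivariateGaussian 0 (1 : Matrix κ κ ℝ)))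
    (x : ι) :
    ∑ y, ∑ z, |∫ w, U'' (matrixCLM A (WithLp.toLp 2 w) + ψ) (EuclideanSpace.single x (1 : ℝ)) (EuclideanSpace.single y (1 : ℝ)) *
            U' (matrixCLM A (WithLp.toLp 2 w) + ψ) (EuclideanSpace.single z (1 : ℝ))
          ∂((volume : Measure (κ → ℝ)).tilted fun z => -(1 / 2 * (z ⬝ᵥ z) + U (matrixCLM A (WithLp.toLp 2 z) + ψ))) -
        (∫ w, U'' (matrixCLM A (WithLp.toLp 2 w) + ψ) (EuclideanSpace.single x (1 : ℝ)) (EuclideanSpace.single y (1 : ℝ))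
          ∂((volume : Measure (κ → ℝ)).tilted fun z => -(1 / 2 * (z ⬝ᵥ z) + U (matrixCLM A (WithLp.toLp 2 z) + ψ)))) *
        (∫ w, U' (matrixCLM A (WithLp.toLp 2 w) + ψ) (EuclideanSpace.single z (1 : ℝ))
          ∂((volume : Measure (κ → ℝ)).tilted fun z => -(1 / 2 * (z ⬝ᵥ z) + U (matrixCLM A (WithLp.toLp 2 z) + ψ))))| ≤
      αr * k3r * (αc * hc) * (1 - γ)⁻¹ * (1 - γ')⁻¹ / (1 - lamA) := by
  haveI : Nonempty ι := ⟨x⟩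
  have hl1 : 0 < 1 - lamA := by linarith
  have hcpos : ∀ _x : κ, 0 < 1 - lamA := fun _ => hl1
  -- Dobrushin's matrix (no precision part) and its Neumann series
  set Cm : Matrix κ κ ℝ := Matrix.of fun x w => (if w = x then 0 else ∑ u, ∑ v, |A u w| * |A v x| * Hk v u) / (1 - lamA) with hCm
  have hJ : ∀ x w : κ, 0 ≤ (if w = x then (0 : ℝ) else ∑ u, ∑ v, |A u w| * |A v x| * Hk v u) := fun x w => by
    split_ifs
    · exact le_rfl
    · exact whitened_cross_nonneg hHk0 A x w
  have hCmnn : ∀ x w, 0 ≤ Cm x w := fun x w => by rw [hCm, Matrix.of_apply]; exact div_nonneg (hJ x w) hl1.le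
  have hCmrow : ∀ x, ∑ w, Cm x w ≤ γ := fun x => by
    simp only [hCm, Matrix.of_apply]
    rw [← Finset.sum_div]
    refine le_trans (div_le_div_of_nonneg_right ?_ hl1.le) hγ
    refine le_trans (Finset.sum_le_sum fun w _ => ?_) (whitened_J_rowsum_le hHk0 hαr hαc hhr x)
    split_ifs
    · exact le_rfl
    · linarith [abs_nonneg ((1 : Matrix κ κ ℝ) x w)]
  have hCmcol : ∀ w, ∑ x, Cm x w ≤ γ' := fun w => by
    simp only [hCm, Matrix.of_apply]
    rw [← Finset.sum_div]
    refine le_trans (div_le_div_of_nonneg_right ?_ hl1.le) hγ'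
    refine le_trans (Finset.sum_le_sum fun x _ => ?_) (whitened_J_colsum_le hHk0 hαr hαc hhc w)
    split_ifs
    · exact le_rfl
    · linarith [abs_nonneg ((1 : Matrix κ κ ℝ) x w)]
  obtain ⟨w₀⟩ := ‹Nonempty κ›
  have hγ0 : 0 ≤ γ := (Finset.sum_nonneg fun z _ => hCmnn w₀ z).trans (hCmrow w₀)
  have hD : ∀ x y, 0 ≤ ∑' n : ℕ, (Cm ^ n) x y := neumann_nonneg hCmnn
  have hDC : ∀ x y, (if x = y then (1 : ℝ) else 0) + ∑ w, (∑' n : ℕ, (Cm ^ n) x w) *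
      ((if y = w then 0 else ∑ u, ∑ v, |A u y| * |A v w| * Hk v u) / (1 - lamA)) ≤ ∑' n : ℕ, (Cm ^ n) x y := by
    intro x y
    have h := neumann_dominates hCmnn hCmrow hγ0 hγ1 x y
    simp only [hCm, Matrix.of_apply] at h ⊢
    exact h
  have hDr : ∀ z, ∑ w, ∑' n : ℕ, (Cm ^ n) z w ≤ (1 - γ)⁻¹ := neumann_rowsum_le hCmnn hCmrow hγ0 hγ1
  have hDc : ∀ w, ∑ z, ∑' n : ℕ, (Cm ^ n) z w ≤ (1 - γ')⁻¹ := neumann_colsum_le hCmnn hCmrow hγ0 hγ1 hCmcol hγ'1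
  -- the moment letters in Lebesgue form
  have hV0 : Integrable (fun z : κ → ℝ => exp (-(1 / 2 * (z ⬝ᵥ z) + U (matrixCLM A (WithLp.toLp 2 z) + ψ)))) := by
    have h := whitened_integrable_lebesgue A ψ (k := fun _ => (1 : ℝ)) (by simpa only [mul_one] using hI0)
    simpa only [one_mul] using h
  have hV2 : ∀ w, Integrable (fun z : κ → ℝ => z w ^ 2 * exp (-(1 / 2 * (z ⬝ᵥ z) + U (matrixCLM A (WithLp.toLp 2 z) + ψ)))) := fun w => by
    have h := whitened_integrable_lebesgue A ψ (k := fun ξ : EuclideanSpace ℝ κ => ξ w ^ 2) (hI2 w)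
    simpa only [PiLp.toLp_apply] using h
  have hrow' : ∀ x : κ, ∑ w, (if w = x then (0 : ℝ) else ∑ u, ∑ v, |A u w| * |A v x| * Hk v u) / (1 - lamA) ≤ γ := fun x => by
    have h := hCmrow x
    simp only [hCm, Matrix.of_apply] at h
    exact h
  have hκc0 : 0 ≤ αc * hc :=
    le_trans (Finset.sum_nonneg fun v _ => whitened_obs_nonneg hHk0 A v w₀) (whitened_obs_colsum_le hHk0 hαc hhc w₀)
  have hγ'0 : 0 ≤ γ' := (Finset.sum_nonneg fun z _ => hCmnn z w₀).trans (hCmcol w₀)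
  have hpos : 0 ≤ αc * hc * (1 - γ)⁻¹ * (1 - γ')⁻¹ / (1 - lamA) := by
    have h1 : 0 < 1 - γ := by linarith
    have h2 : 0 < 1 - γ' := by linarith
    positivity
  -- (447) for each `y`: the observable `G_{xy}` against the family `F_z`
  have hy : ∀ y : ι, ∑ z, |∫ w, U'' (matrixCLM A (WithLp.toLp 2 w) + ψ) (EuclideanSpace.single x (1 : ℝ)) (EuclideanSpace.single y (1 : ℝ)) *
            U' (matrixCLM A (WithLp.toLp 2 w) + ψ) (EuclideanSpace.single z (1 : ℝ))
          ∂((volume : Measure (κ → ℝ)).tilted fun z => -(1 / 2 * (z ⬝ᵥ z) + U (matrixCLM A (WithLp.toLp 2 z) + ψ))) -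
        (∫ w, U'' (matrixCLM A (WithLp.toLp 2 w) + ψ) (EuclideanSpace.single x (1 : ℝ)) (EuclideanSpace.single y (1 : ℝ))
          ∂((volume : Measure (κ → ℝ)).tilted fun z => -(1 / 2 * (z ⬝ᵥ z) + U (matrixCLM A (WithLp.toLp 2 z) + ψ)))) *
        (∫ w, U' (matrixCLM A (WithLp.toLp 2 w) + ψ) (EuclideanSpace.single z (1 : ℝ))
          ∂((volume : Measure (κ → ℝ)).tilted fun z => -(1 / 2 * (z ⬝ᵥ z) + U (matrixCLM A (WithLp.toLp 2 z) + ψ))))| ≤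
      (∑ w, ∑ u, |A u w| * K3 x y u) * (αc * hc) * (1 - γ)⁻¹ * (1 - γ')⁻¹ / (1 - lamA) := fun y =>
    cov_rowsum_le_gibbs
      (P := fun x F ω => (∫ s, F (update ω x s) * exp (-(1 / 2 * (update ω x s ⬝ᵥ update ω x s) + U (matrixCLM A (WithLp.toLp 2 (update ω x s)) + ψ)))) /
        ∫ s, exp (-(1 / 2 * (update ω x s ⬝ᵥ update ω x s) + U (matrixCLM A (WithLp.toLp 2 (update ω x s)) + ψ))))
      (D := fun x y => ∑' n : ℕ, (Cm ^ n) x y)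
      (V := fun z => 1 / 2 * (z ⬝ᵥ z) + U (matrixCLM A (WithLp.toLp 2 z) + ψ))
      (V₁ := fun x z => z x + U' (matrixCLM A (WithLp.toLp 2 z) + ψ) (matrixCLM A (EuclideanSpace.single x (1 : ℝ))))
      (c := fun _ => 1 - lamA) (Cw := 1 + lamA) (J := fun x w => if w = x then 0 else ∑ u, ∑ v, |A u w| * |A v x| * Hk v u) (γ := γ)
      (F := fun w => U'' (matrixCLM A (WithLp.toLp 2 w) + ψ) (EuclideanSpace.single x (1 : ℝ)) (EuclideanSpace.single y (1 : ℝ)))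
      (Gf := fun z w => U' (matrixCLM A (WithLp.toLp 2 w) + ψ) (EuclideanSpace.single z (1 : ℝ)))
      (a := fun w => ∑ u, |A u w| * K3 x y u) (bf := fun z w => ∑ u, |A u w| * Hk z u)
      (dr := (1 - γ)⁻¹) (dc := (1 - γ')⁻¹) (cmin := 1 - lamA) (κc := αc * hc) Finset.univ
      (fun _ _ _ => rfl) (fun x z => whitenedV_hasDerivAt hUd A ψ x z) (fun x z s t => whitenedV_floor hU'd hHk A hlam ψ x z s t) hcpos
      (fun x z s t => whitenedV_ceiling hU'd hHk A hlam ψ x z s t)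
      (fun x w hw z s t => by rw [if_neg hw]; exact whitenedV_cross hU'd hHk A ψ x w hw z s t)
      (whitenedV_continuous hUd A ψ) hV0 hV2 hJ (fun x => by simp) hrow' hγ0 hγ1 hD hDC hDr hDc hl1 (fun _ => le_rfl)
      (fun w z s t => hessian_obs_lipVec hU''d hK3 A ψ x y w z s t) (fun z w z' s t => whitened_obs_lipVec hU'd hHk A ψ z w z' s t)
      (fun w => whitened_obs_colsum_le hHk0 hαc hhc w)
  -- sum over `y`
  refine (Finset.sum_le_sum fun y _ => hy y).trans ?_
  have e : ∀ y, (∑ w, ∑ u, |A u w| * K3 x y u) * (αc * hc) * (1 - γ)⁻¹ * (1 - γ')⁻¹ / (1 - lamA) =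
      (∑ w, ∑ u, |A u w| * K3 x y u) * (αc * hc * (1 - γ)⁻¹ * (1 - γ')⁻¹ / (1 - lamA)) := fun y => by ring
  simp_rw [e]
  rw [← Finset.sum_mul]
  calc (∑ y, ∑ w, ∑ u, |A u w| * K3 x y u) * (αc * hc * (1 - γ)⁻¹ * (1 - γ')⁻¹ / (1 - lamA))
      ≤ (αr * k3r) * (αc * hc * (1 - γ)⁻¹ * (1 - γ')⁻¹ / (1 - lamA)) := mul_le_mul_of_nonneg_right (hessian_obs_mass_le hK30 hαr hk3r x) hpos
    _ = αr * k3r * (αc * hc) * (1 - γ)⁻¹ * (1 - γ')⁻¹ / (1 - lamA) := by ring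

/-! ## §3. THE END: the two-point piece under `N(0, AAᵀ)` -/

/-- **THE TWO-POINT PIECE OF `∂³W`'S KERNEL LETTER UNDER `N(0,AAᵀ)`**: for the `C³` block class (`Hk`, `K3` majorants with their letters),
the factor's letters, the smallness and the two regulators (moment letters discharged by (458)),
`Σ_y Σ_z |Z⁻¹∫e^{−U}U″e_xe_y·U′e_z − Z⁻²(∫e^{−U}U″e_xe_y)(∫e^{−U}U′e_z)| ≤ (αr·k3r)(αc·hc)(1−γ)⁻¹(1−γ′)⁻¹∕(1−lamA)`. [folklore] -/
theorem whitened_hessgrad_cov_kernel_letter [Nonempty κ] (hΓop : (γop • (1 : Matrix ι ι ℝ) - A * Aᵀ).PosSemidef) (Y : Finset ι)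
    (hUd : ∀ φ : EuclideanSpace ℝ ι, HasFDerivAt U (U' φ) φ) (hU'd : ∀ φ : EuclideanSpace ℝ ι, HasFDerivAt U' (U'' φ) φ)
    (hU''d : ∀ φ : EuclideanSpace ℝ ι, HasFDerivAt U'' (U₃ φ) φ)
    (hHk : ∀ (φ : EuclideanSpace ℝ ι) (x z : ι), |U'' φ (EuclideanSpace.single z (1 : ℝ)) (EuclideanSpace.single x (1 : ℝ))| ≤ Hk x z)
    (hHk0 : ∀ v u, 0 ≤ Hk v u)
    (hK3 : ∀ (φ : EuclideanSpace ℝ ι) (u x y : ι),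
      |U₃ φ (EuclideanSpace.single u (1 : ℝ)) (EuclideanSpace.single x (1 : ℝ)) (EuclideanSpace.single y (1 : ℝ))| ≤ K3 x y u)
    (hK30 : ∀ x y u, 0 ≤ K3 x y u) (hκ₀ : 0 ≤ κ₀) (hτ : 0 < τ) (hδ : 0 < δ) (hθ1 : θ < 1) (hκθ : 2 * κ₀ * (1 + τ) * γop ≤ θ)
    (hκθw : 2 * κ₀ * (1 + τ) * γop + 4 * δ ≤ θ) (hstab : ∀ φ : EuclideanSpace ℝ ι, -(κ₀ * ∑ x ∈ Y, φ x ^ 2) ≤ U φ) (ψ : EuclideanSpace ℝ ι)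
    (hαr : ∀ u, ∑ w, |A u w| ≤ αr) (hαc : ∀ w, ∑ u, |A u w| ≤ αc) (hhr : ∀ v, ∑ u, Hk v u ≤ hr) (hhc : ∀ u, ∑ v, Hk v u ≤ hc)
    (hk3r : ∀ x, ∑ y, ∑ u, K3 x y u ≤ k3r)
    (hlam : ∀ x : κ, ∑ u, ∑ v, |A u x| * |A v x| * Hk v u ≤ lamA) (hlam1 : lamA < 1)
    (hγ : αc * hr * αr / (1 - lamA) ≤ γ) (hγ1 : γ < 1) (hγ' : αc * hc * αr / (1 - lamA) ≤ γ') (hγ'1 : γ' < 1) (x : ι) :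
    ∑ y, ∑ z, |((∫ ω : EuclideanSpace ℝ ι, exp (-U (ω + ψ)) ∂(multivariateGaussian 0 (A * Aᵀ)))⁻¹ * (∫ ω : EuclideanSpace ℝ ι, exp (-U (ω + ψ)) *
          (U'' (ω + ψ) (EuclideanSpace.single x (1 : ℝ)) (EuclideanSpace.single y (1 : ℝ)) * U' (ω + ψ) (EuclideanSpace.single z (1 : ℝ)))
            ∂(multivariateGaussian 0 (A * Aᵀ))) - ((∫ ω : EuclideanSpace ℝ ι, exp (-U (ω + ψ)) ∂(multivariateGaussian 0 (A * Aᵀ))) ^ 2)⁻¹ *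
          ((∫ ω : EuclideanSpace ℝ ι, exp (-U (ω + ψ)) * U'' (ω + ψ) (EuclideanSpace.single x (1 : ℝ)) (EuclideanSpace.single y (1 : ℝ))
            ∂(multivariateGaussian 0 (A * Aᵀ))) * (∫ ω : EuclideanSpace ℝ ι, exp (-U (ω + ψ)) * U' (ω + ψ) (EuclideanSpace.single z (1 : ℝ))
            ∂(multivariateGaussian 0 (A * Aᵀ)))))| ≤
      αr * k3r * (αc * hc) * (1 - γ)⁻¹ * (1 - γ')⁻¹ / (1 - lamA) := by
  haveI : Nonempty ι := ⟨x⟩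
  have hUc : Continuous U := continuous_iff_continuousAt.2 fun φ => (hUd φ).continuousAt
  have hU'c : Continuous U' := continuous_iff_continuousAt.2 fun φ => (hU'd φ).continuousAt
  have hU''c : Continuous U'' := continuous_iff_continuousAt.2 fun φ => (hU''d φ).continuousAt
  -- the moment letters ((458))
  have hI0 := whitened_exp_integrable hΓop Y hUc.measurable hκ₀ hτ hθ1 hκθ hstab ψ
  have hI2 := fun w => whitened_second_moment_integrable hΓop Y hUc.measurable hκ₀ hτ hδ hθ1 hκθw hstab ψ w
  have h := whitened_hessgrad_cov_raw hUd hU'd hU''d hHk hHk0 hK3 hK30 A ψ hαr hαc hhr hhc hk3r hlam hlam1 hγ hγ1 hγ' hγ'1 hI0 hI2 x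
  -- measurability of the integrands (all continuous)
  have hsh : Continuous fun ω : EuclideanSpace ℝ ι => ω + ψ := continuous_id.add continuous_const
  have he : Continuous fun ω : EuclideanSpace ℝ ι => exp (-U (ω + ψ)) := continuous_exp.comp (hUc.comp hsh).neg
  have hg : ∀ v : ι, Continuous fun ω : EuclideanSpace ℝ ι => U' (ω + ψ) (EuclideanSpace.single v (1 : ℝ)) := fun v =>
    (hU'c.comp hsh).clm_apply continuous_const
  have hG : ∀ y : ι, Continuous fun ω : EuclideanSpace ℝ ι => U'' (ω + ψ) (EuclideanSpace.single x (1 : ℝ)) (EuclideanSpace.single y (1 : ℝ)) := fun y =>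
    ((hU''c.comp hsh).clm_apply continuous_const).clm_apply continuous_const
  have hm0 : AEStronglyMeasurable (fun ω : EuclideanSpace ℝ ι => exp (-U (ω + ψ))) (multivariateGaussian 0 (A * Aᵀ)) := he.aestronglyMeasurable
  have hm1 : ∀ v : ι, AEStronglyMeasurable (fun ω : EuclideanSpace ℝ ι => exp (-U (ω + ψ)) * U' (ω + ψ) (EuclideanSpace.single v (1 : ℝ)))
      (multivariateGaussian 0 (A * Aᵀ)) := fun v => (he.mul (hg v)).aestronglyMeasurable
  have hmG : ∀ y : ι, AEStronglyMeasurable (fun ω : EuclideanSpace ℝ ι => exp (-U (ω + ψ)) * U'' (ω + ψ) (EuclideanSpace.single x (1 : ℝ))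
      (EuclideanSpace.single y (1 : ℝ))) (multivariateGaussian 0 (A * Aᵀ)) := fun y => (he.mul (hG y)).aestronglyMeasurable
  have hm2 : ∀ y z : ι, AEStronglyMeasurable (fun ω : EuclideanSpace ℝ ι => exp (-U (ω + ψ)) * (U'' (ω + ψ) (EuclideanSpace.single x (1 : ℝ))
      (EuclideanSpace.single y (1 : ℝ)) * U' (ω + ψ) (EuclideanSpace.single z (1 : ℝ)))) (multivariateGaussian 0 (A * Aᵀ)) := fun y z =>
    (he.mul ((hG y).mul (hg z))).aestronglyMeasurable
  refine le_trans (le_of_eq (Finset.sum_congr rfl fun y _ => Finset.sum_congr rfl fun z _ => ?_)) h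
  rw [whitened_tilted_eq_gauss A ψ, whitened_tilted_eq_gauss A ψ, whitened_tilted_eq_gauss A ψ]
  simp only [WithLp.toLp_ofLp]
  rw [whitened_integral_eq A hm0, whitened_integral_eq A (hm2 y z), whitened_integral_eq A (hmG y), whitened_integral_eq A (hm1 z)]
  congr 1
  ring

end Summit.QuantumFields.BalabanUV.T4Continuum.NE7b.SupWhitenedHessianGradientCovariance

end
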